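import Literature.Geometry.Kaehler.ComplexTorusCyclotomicAutomorphismOrderFour
import Literature.Geometry.Kaehler.ComplexTorusCyclotomicAutomorphismOrderFive
import Literature.LinearAlgebra.Matrix.CrystallographicRestriction
import HarnessLib

/-!
# Automorphisms of order `2p^a` versus `p^a`: `P_u = Φ_{2p^a}` is forced in rank `φ(2p^a)`, `−u` has order
# `p^a` — only one elliptic curve with an automorphism of order `6`, only one abelian surface with one of order `10`

Layer `Literature/Geometry/Kaehler`, namespace `Literature.Geometry.Kaehler.ComplexTorus`; lane `lit-hodgefound`
(Track 2 foundations library), Layer A2/A3 junction, row «A2-26(ga)» (self-proposed 2026-08-28, prover seat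
`lit-hodgefound-p10`, generation 31, FILE 9).  FILE 2 turned «`u` of prime-power order `q` on a torus of dimension
`φ(q)/2`» into «`P_u = Φ_q`» (Bamberg–Cairns–Kilminster: `Φ_q ∣ minpoly`); for a general order `n` this fails
(`diag(ζ_4, ζ_3)` has order `12` in rank `4 = φ(12)` with `P = Φ_4 Φ_3`).  THIS FILE treats the orders `n = 2p^a`,
`p` an odd prime, `φ(n) = φ(p^a)`: in the cyclotomic content `S(u) = {d ∣ n : Φ_d ∣ minpoly u}` of the tree's
`Literature.LinearAlgebra.Matrix.CrystallographicRestriction` every maximal prime power of `n` divides a member, so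
`n ∉ S` would put `p^a` and an even `d` in `S`, of total degree `≥ φ(p^a) + 1 > rank`; hence `P_u = Φ_{2p^a}`.
Then `(X, u) ≅ (ℂ^Φ/Φ(𝔞), ζ_{2p^a})` (FILE 1) and `−u ↔ −ζ_{2p^a}`, a primitive `p^a`-th root of unity: `−u` has
order `p^a` — so the tori carrying an automorphism of order `2p^a` are exactly those carrying one of order `p^a`
(in the right dimension), and FILES 4, 5 give: ONE elliptic curve with an automorphism of order `6` (`= ` the one
with order `3`), ONE abelian surface with an automorphism of order `10` (`=` the one with order `5`).

WHAT IS PROVED (theorems only; no `def`, no instance, no named fact; net debt 0).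
* §1 (matrices) **`charpoly_eq_cyclotomic_of_orderOf_eq_two_mul_prime_pow`** (`A ∈ M_ι(ℤ)` or `M_ι(ℚ)`,
  `orderOf A = 2p^{a+1}`, `p` odd, `#ι = φ(p^{a+1})` ⟹ `P_A = Φ_{2p^{a+1}}`).
* §2 (roots of unity) `isPrimitiveRoot_neg_of_two_mul_prime_pow` (`ζ` of order `2p^{a+1}` ⟹ `−ζ` of order
  `p^{a+1}`), `isPrimitiveRoot_neg_of_prime_pow` (conversely).
* §3 (tori) **`orderOf_neg_of_orderOf_eq_two_mul_prime_pow`** (`u ∈ End X`, `orderOf u = 2p^{a+1}`,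
  `2 dim X = φ(p^{a+1})` ⟹ `orderOf (−u) = p^{a+1}`), `orderOf_neg_of_orderOf_eq_prime_pow` (conversely),
  through the injective `ρ : 𝓞_{ℚ(ζ)} → End X`, `ρ(ζ) = u` of FILE 1.
* §4 `d = 6`: `orderOf_neg_eq_three_of_orderOf_eq_six` (and `six_of_three`), **`exists_iso_of_orderOf_eq_six`**
  (ANY two one-dimensional complex tori with endomorphisms `u, u′` of order `6` are isomorphic, by a biholomorphic
  group isomorphism `g` with `g ∘ (−u)^k = (−u′) ∘ g`, `k ∈ {1, 2}`), `isIsomorphic_of_orderOf_eq_six`,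
  `isIsomorphic_of_orderOf_eq_three_six` (order `3` on one, order `6` on the other) — ONLY ONE ELLIPTIC CURVE WITH
  AN AUTOMORPHISM OF ORDER `6`.
* §5 `d = 10`: `orderOf_neg_eq_five_of_orderOf_eq_ten`, **`isIsomorphic_of_orderOf_eq_ten`** (any two
  `2`-dimensional complex tori with endomorphisms of order `10` are isomorphic), `isIsomorphic_of_orderOf_eq_five_ten`
  — ONLY ONE ABELIAN SURFACE WITH AN AUTOMORPHISM OF ORDER `10`.

Sources.  J. Bamberg, G. Cairns, D. Kilminster, *The crystallographic restriction, permutations, and Goldbach's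
conjecture*, Amer. Math. Monthly 110 (2003), Thm. 1 (proof: `S = {d : Φ_d ∣ minpoly}`, every maximal prime power
of the order divides some `d ∈ S`, `Σ φ(d) ≤ n`) — as formalised in the tree's `CrystallographicRestriction`;
Ch. Birkenhake, H. Lange, *Complex Abelian Varieties*, 2nd ed. (2004), §13.3 Cor. 13.3.4 (`g = 1`: automorphisms
of order `4` resp. `3, 6` ⟹ `E ≅ ℂ/ℤ[i]` resp. `ℂ/ℤ[ζ_3]`) — not held (acq-10211), locator as cited by this lane's
earlier rows; G. Shimura, *Introduction to the Arithmetic Theory of Automorphic Functions* (1971), §4.5, p. 106, as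
cited by the tree's `CMTorusQuadraticOrderAutomorphisms`; G. Shimura, *Abelian Varieties with Complex Multiplication
and Modular Functions* (1998), §7.4 Prop. 17 p. 58, §8.4 (1)–(2) pp. 65, 73.

## References

* [Brzezinski2018] J. Brzeziński, *Galois Theory Through Exercises*, Springer (2018), Exercise 10.4
  (`Φ_{2m}(X) = Φ_m(−X)`, `m > 1` odd; held, pp. 0065/0227).
* [BambergCairnsKilminster2003] J. Bamberg, G. Cairns, D. Kilminster, *The crystallographic restriction,
  permutations, and Goldbach's conjecture*, Amer. Math. Monthly 110 (2003) 202–209, Thm. 1.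
* [BirkenhakeLange2004] Ch. Birkenhake, H. Lange, *Complex Abelian Varieties*, 2nd ed., Grundlehren 302 (2004), §13.3.
* [Shimura1973] G. Shimura, *Introduction to the Arithmetic Theory of Automorphic Functions*, Princeton (1971), §4.5.
* [Shimura1998] G. Shimura, *Abelian Varieties with Complex Multiplication and Modular Functions*, Princeton
  Univ. Press (1998), §7.4 Prop. 17 p. 58, §8.4 pp. 65, 73.
-/

noncomputable section

open scoped Classical nonZeroDivisors NumberField Manifold ContDiff
open NumberField Module Polynomial

namespace Literature.Geometry.Kaehler

namespace ComplexTorus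

open Literature.LinearAlgebra.Matrix (cyclotomicDivisors mem_cyclotomicDivisors
  exists_ordProj_dvd_of_mem_primeFactors_orderOf sum_totient_filter_le_card prod_cyclotomic_filter_dvd_minpoly)

/-! ### §1 `orderOf A = 2p^a` in rank `φ(2p^a)` forces `P_A = Φ_{2p^a}` -/

section MatrixAlgebra

variable {ι : Type} [Fintype ι] [DecidableEq ι]

/-- `v_p(2 p^k) = k` for an odd prime `p`. [folklore] -/
private theorem factorization_two_mul_pow_self {p : ℕ} (hp : p.Prime) (hp2 : p ≠ 2) (k : ℕ) :
    (2 * p ^ k).factorization p = k := by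
  rw [Nat.factorization_mul two_ne_zero (pow_ne_zero k hp.ne_zero), Finsupp.add_apply, Nat.factorization_pow,
    Finsupp.smul_apply, hp.factorization_self, Nat.prime_two.factorization, Finsupp.single_apply, if_neg hp2.symm]
  simp

/-- `v_2(2 p^k) = 1` for an odd prime `p`. [folklore] -/
private theorem factorization_two_mul_pow_two {p : ℕ} (hp : p.Prime) (hp2 : p ≠ 2) (k : ℕ) :
    (2 * p ^ k).factorization 2 = 1 := by
  rw [Nat.factorization_mul two_ne_zero (pow_ne_zero k hp.ne_zero), Finsupp.add_apply, Nat.factorization_pow,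
    Finsupp.smul_apply, Nat.prime_two.factorization_self, hp.factorization, Finsupp.single_apply, if_neg hp2]
  simp

/-- `φ(2 p^k) = φ(p^k)` for an odd prime `p`. [folklore] -/
private theorem totient_two_mul_pow {p : ℕ} (hp : p.Prime) (hp2 : p ≠ 2) (k : ℕ) :
    Nat.totient (2 * p ^ k) = Nat.totient (p ^ k) := by
  have hcop : Nat.Coprime 2 (p ^ k) :=
    (Nat.coprime_primes Nat.prime_two hp).2 hp2.symm |>.pow_right k
  rw [Nat.totient_mul hcop, Nat.totient_two, one_mul]

/-- **`P_A = Φ_{2p^{a+1}}` over `ℚ`**: a matrix `A ∈ M_ι(ℚ)` of order `2p^{a+1}` (`p` an odd prime) in rank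
`#ι = φ(p^{a+1})` has characteristic polynomial `Φ_{2p^{a+1}}`.  In Bamberg–Cairns–Kilminster's
`S = {d ∣ 2p^{a+1} : Φ_d ∣ minpoly A}` every maximal prime power of the order divides a member and
`Σ_{d∈S} φ(d) ≤ #ι`; were `2p^{a+1} ∉ S`, then `p^{a+1} ∈ S` and some even `d ∈ S`, of total degree
`≥ φ(p^{a+1}) + 1 > #ι`.  So `Φ_{2p^{a+1}} ∣ minpoly A ∣ P_A`, both monic of degree `#ι`.
[cite: BambergCairnsKilminster2003, Thm. 1 (proof)] -/
theorem charpoly_eq_cyclotomic_of_orderOf_eq_two_mul_prime_pow_rat {p : ℕ} (hp : p.Prime) (hp2 : p ≠ 2) (a : ℕ)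
    {A : Matrix ι ι ℚ} (hord : orderOf A = 2 * p ^ (a + 1)) (hcard : Fintype.card ι = Nat.totient (p ^ (a + 1))) :
    A.charpoly = cyclotomic (2 * p ^ (a + 1)) ℚ := by
  set n := 2 * p ^ (a + 1) with hn
  have hpk : 0 < p ^ (a + 1) := pow_pos hp.pos _
  have hn0 : 0 < n := Nat.mul_pos two_pos hpk
  have hA : 0 < orderOf A := by rw [hord]; exact hn0
  -- `n ∈ S`
  have hmem : n ∈ cyclotomicDivisors A := by
    by_contra hnot
    -- `p^{a+1} ∈ S`
    obtain ⟨d₁, hd₁, hpd₁⟩ := exists_ordProj_dvd_of_mem_primeFactors_orderOf A hA (p := p)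
      (by rw [Nat.mem_primeFactors, hord]; exact ⟨hp, dvd_mul_of_dvd_right (dvd_pow_self p (Nat.succ_ne_zero a)) 2,
        hn0.ne'⟩)
    rw [hord, factorization_two_mul_pow_self hp hp2] at hpd₁
    have hd₁n : d₁ ∣ n := by
      have h := Nat.dvd_of_mem_divisors (mem_cyclotomicDivisors.1 hd₁).1
      rwa [hord] at h
    have hd₁eq : d₁ = p ^ (a + 1) := by
      obtain ⟨e, he⟩ := hpd₁
      obtain ⟨f, hf⟩ := hd₁n
      -- `p^{a+1} e f = 2 p^{a+1}`, so `e f = 2`, `e ∈ {1, 2}`; `e = 2` would give `d₁ = n ∈ S`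
      have hef : e * f = 2 := by
        have h : p ^ (a + 1) * (e * f) = p ^ (a + 1) * 2 := by rw [← mul_assoc, ← he, ← hf, hn, mul_comm]
        exact Nat.eq_of_mul_eq_mul_left hpk h
      have he2 : e ∣ 2 := ⟨f, hef.symm⟩
      have he' : e = 1 ∨ e = 2 := by
        have := (Nat.dvd_prime Nat.prime_two).1 he2
        exact this
      rcases he' with rfl | rfl
      · rw [he, mul_one]
      · exfalso
        apply hnot
        have hd : d₁ = n := by rw [he, hn, mul_comm]
        rw [← hd]
        exact hd₁
    -- an even `d₂ ∈ S`
    obtain ⟨d₂, hd₂, h2d₂⟩ := exists_ordProj_dvd_of_mem_primeFactors_orderOf A hA (p := 2)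
      (by rw [Nat.mem_primeFactors, hord]; exact ⟨Nat.prime_two, dvd_mul_right 2 _, hn0.ne'⟩)
    rw [hord, factorization_two_mul_pow_two hp hp2, pow_one] at h2d₂
    have hd₂pos : 0 < d₂ := Nat.pos_of_mem_divisors (mem_cyclotomicDivisors.1 hd₂).1
    have hne : d₁ ≠ d₂ := by
      rintro rfl
      rw [hd₁eq] at h2d₂
      exact hp2 ((Nat.prime_dvd_prime_iff_eq Nat.prime_two hp).1 (Nat.prime_two.dvd_of_dvd_pow h2d₂)).symm
    -- degrees: `φ(d₁) + φ(d₂) ≤ Σ_S φ ≤ #ι = φ(p^{a+1}) = φ(d₁)`, but `φ(d₂) ≥ 1`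
    have hsum := sum_totient_filter_le_card A
    have hsub : ({d₁, d₂} : Finset ℕ) ⊆ cyclotomicDivisors A := by
      intro d hd
      simp only [Finset.mem_insert, Finset.mem_singleton] at hd
      rcases hd with rfl | rfl
      · exact hd₁
      · exact hd₂
    have h2 := (Finset.sum_le_sum_of_subset hsub).trans hsum
    rw [Finset.sum_pair hne, hd₁eq, hcard] at h2
    have hpos : 0 < Nat.totient d₂ := Nat.totient_pos.2 hd₂pos
    omega
  -- `Φ_n ∣ minpoly A ∣ P_A`, both monic of degree `#ι`
  have hdvd : cyclotomic n ℚ ∣ A.charpoly :=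
    (mem_cyclotomicDivisors.1 hmem).2.trans (Matrix.minpoly_dvd_charpoly A)
  refine eq_of_monic_of_dvd_of_natDegree_le (cyclotomic.monic _ ℚ) (Matrix.charpoly_monic A) hdvd ?_
  rw [Matrix.charpoly_natDegree_eq_dim, natDegree_cyclotomic, hcard, hn, totient_two_mul_pow hp hp2]

/-- **`P_A = Φ_{2p^{a+1}}` over `ℤ`** (the same for integer matrices, through `M_ι(ℤ) → M_ι(ℚ)`).
[cite: BambergCairnsKilminster2003, Thm. 1 (proof)] -/
theorem charpoly_eq_cyclotomic_of_orderOf_eq_two_mul_prime_pow {p : ℕ} (hp : p.Prime) (hp2 : p ≠ 2) (a : ℕ)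
    {A : Matrix ι ι ℤ} (hord : orderOf A = 2 * p ^ (a + 1)) (hcard : Fintype.card ι = Nat.totient (p ^ (a + 1))) :
    A.charpoly = cyclotomic (2 * p ^ (a + 1)) ℤ := by
  set F : Matrix ι ι ℤ →+* Matrix ι ι ℚ := (Int.castRingHom ℚ).mapMatrix with hF
  have hinj : Function.Injective F := fun M N h ↦
    Matrix.map_injective (Int.cast_injective (α := ℚ)) (by simpa [hF] using h)
  have hord' : orderOf (F A) = 2 * p ^ (a + 1) := by
    rw [← hord]
    exact orderOf_injective F.toMonoidHom hinj A
  have hQ := charpoly_eq_cyclotomic_of_orderOf_eq_two_mul_prime_pow_rat hp hp2 a hord' hcard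
  apply Polynomial.map_injective (Int.castRingHom ℚ) (Int.castRingHom ℚ).injective_int
  rw [map_cyclotomic_int, ← Matrix.charpoly_map]
  exact hQ

end MatrixAlgebra

/-! ### §2 `−ζ_{2p^a}` is a primitive `p^a`-th root of unity, and conversely -/

section Roots

variable {R : Type*} [CommRing R] [IsDomain R]

/-- **`ζ` of order `2p^{a+1}` (`p` odd) ⟹ `−ζ` of order `p^{a+1}`**: `ζ^{p^{a+1}} = −1`, so
`(−ζ)^{p^{a+1}} = 1`, while `(−ζ)^{p^a} = 1` would give `ζ^{2p^a} = 1` («Let `ε` be a primitive `m`-th root of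
unity … `−ε` is a primitive `2m`-th root of unity», `m` odd). [cite: Brzezinski2018, Exercise 10.4 and its solution
(`Φ_{2m}(X) = Φ_m(−X)` for odd `m > 1`), pp. 0065, 0227] -/
theorem isPrimitiveRoot_neg_of_two_mul_prime_pow {p : ℕ} (hp : p.Prime) (hp2 : p ≠ 2) {a : ℕ} {ζ : R}
    (hζ : IsPrimitiveRoot ζ (2 * p ^ (a + 1))) : IsPrimitiveRoot (-ζ) (p ^ (a + 1)) := by
  haveI : Fact p.Prime := ⟨hp⟩
  have hodd : Odd p := hp.odd_of_ne_two hp2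
  have hpk : 0 < p ^ (a + 1) := pow_pos hp.pos _
  have h1 : ζ ^ p ^ (a + 1) = -1 :=
    (hζ.pow (Nat.mul_pos two_pos hpk) (mul_comm 2 (p ^ (a + 1)))).eq_neg_one_of_two_right
  rw [IsPrimitiveRoot.iff_orderOf]
  refine orderOf_eq_prime_pow (fun h ↦ ?_) ?_
  · -- `(−ζ)^{p^a} = 1 ⟹ ζ^{2p^a} = 1 ⟹ 2p^{a+1} ∣ 2p^a`
    rw [(hodd.pow).neg_pow, neg_eq_iff_eq_neg] at h
    have h2 : ζ ^ (2 * p ^ a) = 1 := by rw [mul_comm, pow_mul, h, neg_one_sq]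
    have hdvd := (hζ.pow_eq_one_iff_dvd _).1 h2
    have hlt : 2 * p ^ a < 2 * p ^ (a + 1) :=
      Nat.mul_lt_mul_of_pos_left (Nat.pow_lt_pow_right hp.one_lt (Nat.lt_succ_self a)) two_pos
    exact absurd (Nat.le_of_dvd (Nat.mul_pos two_pos (pow_pos hp.pos _)) hdvd) (not_le.2 hlt)
  · rw [(hodd.pow).neg_pow, h1, neg_neg]

omit [IsDomain R] in
/-- **Conversely `ζ` of order `p^{a+1}` (`p` odd) ⟹ `−ζ = (−1)·ζ` of order `2p^{a+1}`** (coprime orders; `R` of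
characteristic `0`, e.g. a number field). [cite: Brzezinski2018, Exercise 10.4 (solution: «`−ε` is a primitive
`2m`-th root of unity»), p. 0227] -/
theorem isPrimitiveRoot_neg_of_prime_pow [CharZero R] {p : ℕ} (hp : p.Prime) (hp2 : p ≠ 2) {a : ℕ} {ζ : R}
    (hζ : IsPrimitiveRoot ζ (p ^ (a + 1))) : IsPrimitiveRoot (-ζ) (2 * p ^ (a + 1)) := by
  rw [IsPrimitiveRoot.iff_orderOf, ← neg_one_mul]
  have h2 : orderOf (-1 : R) = 2 := by
    rw [orderOf_neg_one, if_neg]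
    rw [ringChar.eq_zero]
    norm_num
  have hcop : (orderOf (-1 : R)).Coprime (orderOf ζ) := by
    rw [h2, ← hζ.eq_orderOf]
    exact ((Nat.coprime_primes Nat.prime_two hp).2 hp2.symm).pow_right _
  rw [(Commute.all (-1 : R) ζ).orderOf_mul_eq_mul_orderOf_of_coprime hcop, h2, ← hζ.eq_orderOf]

end Roots

/-! ### §3 On a torus of dimension `φ(p^a)/2`: `u` has order `2p^a` iff `−u` has order `p^a` -/

section Torus

variable {ι : Type} [Fintype ι] [DecidableEq ι] {E : Type} [NormedAddCommGroup E] [NormedSpace ℂ E]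
  {P : (ι → ℝ) ≃L[ℝ] E} {ι' : Type} [Fintype ι'] [DecidableEq ι'] {E' : Type} [NormedAddCommGroup E']
  [NormedSpace ℂ E'] {P' : (ι' → ℝ) ≃L[ℝ] E'}

omit [DecidableEq ι] in
/-- `rank Λ = 2 dim_ℂ E`. [cite: Shimura1998, §3.1, p. 17] -/
private theorem card_eq_two_mul_finrank₃₉ (P : (ι → ℝ) ≃L[ℝ] E) : Fintype.card ι = 2 * finrank ℂ E := by
  have h1 : finrank ℝ (ι → ℝ) = finrank ℝ E := P.toLinearEquiv.finrank_eq
  rw [finrank_fintype_fun_eq_card, finrank_real_of_complex] at h1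
  exact h1

/-- `orderOf` is read through the injective `ρ : 𝓞 K → End X` of FILE 1 and `𝓞 K ⊆ K`: the order of `ρ(x)` is the
order of `x ∈ K`. [cite: Shimura1998, §6.1 Thm. 2, p. 41] -/
private theorem orderOf_ringHom_eq {K : Type} [Field K] [NumberField K] {ρ : 𝓞 K →+* Matrix ι ι ℤ}
    (hρ : Function.Injective ρ) (x : 𝓞 K) : orderOf (ρ x) = orderOf (algebraMap (𝓞 K) K x) := by
  have h1 : orderOf (ρ x) = orderOf x := orderOf_injective ρ.toMonoidHom hρ x
  have h2 : orderOf (algebraMap (𝓞 K) K x) = orderOf x :=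
    orderOf_injective (algebraMap (𝓞 K) K).toMonoidHom (IsFractionRing.injective (𝓞 K) K) x
  rw [h1, h2]

set_option backward.isDefEq.respectTransparency false in -- Mathlib's instance
-- `IsCyclotomicExtension {n} ℚ (CyclotomicField n ℚ)` is keyed on `CyclotomicField.algebra`, the goal on
-- `DivisionRing.toRatAlgebra` (same workaround as FILE 1 `isAbelianVariety_of_charpoly_eq_cyclotomic`)
/-- **An endomorphism with `P_u = Φ_{2p^{a+1}}` has `−u` of order `p^{a+1}`**: `u = ρ(ζ)` for the injective
`ρ : 𝓞_{ℚ(ζ)} → End X` of FILE 1 (`ζ` of order `2p^{a+1}`), and `−u = ρ(−ζ)` with `−ζ` of order `p^{a+1}`.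
[cite: Shimura1998, §6.1 Thm. 2, p. 41] [cite: BirkenhakeLange2004, §13.3] -/
theorem orderOf_neg_of_charpoly_eq_cyclotomic_two_mul_prime_pow {p : ℕ} (hp : p.Prime) (hp2 : p ≠ 2) (a : ℕ)
    {A : Matrix ι ι ℤ} (hA : A ∈ endRingInt P) (hP : A.charpoly = cyclotomic (2 * p ^ (a + 1)) ℤ) :
    orderOf (-A) = p ^ (a + 1) := by
  haveI : NeZero (2 * p ^ (a + 1)) := ⟨(Nat.mul_pos two_pos (pow_pos hp.pos _)).ne'⟩
  have hζ := IsCyclotomicExtension.zeta_spec (2 * p ^ (a + 1)) ℚ (CyclotomicField (2 * p ^ (a + 1)) ℚ)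
  obtain ⟨ρ, hρ⟩ := exists_ringHom_toInteger_eq hζ A (aeval_eq_zero_of_charpoly_eq_cyclotomic hP)
  subst hρ
  have hinj := ringHom_injective_of_charpoly_eq_cyclotomic hζ ρ hA hP
  rw [← map_neg, orderOf_ringHom_eq hinj, map_neg]
  exact (isPrimitiveRoot_neg_of_two_mul_prime_pow hp hp2 hζ).eq_orderOf.symm

set_option backward.isDefEq.respectTransparency false in -- see above
/-- **An endomorphism with `P_u = Φ_{p^{a+1}}` (`p` odd) has `−u` of order `2p^{a+1}`.**
[cite: Shimura1998, §6.1 Thm. 2, p. 41] [cite: BirkenhakeLange2004, §13.3] -/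
theorem orderOf_neg_of_charpoly_eq_cyclotomic_prime_pow {p : ℕ} (hp : p.Prime) (hp2 : p ≠ 2) (a : ℕ)
    {A : Matrix ι ι ℤ} (hA : A ∈ endRingInt P) (hP : A.charpoly = cyclotomic (p ^ (a + 1)) ℤ) :
    orderOf (-A) = 2 * p ^ (a + 1) := by
  haveI : NeZero (p ^ (a + 1)) := ⟨pow_ne_zero _ hp.ne_zero⟩
  have hζ := IsCyclotomicExtension.zeta_spec (p ^ (a + 1)) ℚ (CyclotomicField (p ^ (a + 1)) ℚ)
  obtain ⟨ρ, hρ⟩ := exists_ringHom_toInteger_eq hζ A (aeval_eq_zero_of_charpoly_eq_cyclotomic hP)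
  subst hρ
  have hinj := ringHom_injective_of_charpoly_eq_cyclotomic hζ ρ hA hP
  rw [← map_neg, orderOf_ringHom_eq hinj, map_neg]
  exact (isPrimitiveRoot_neg_of_prime_pow hp hp2 hζ).eq_orderOf.symm

/-- **ORDER `2p^{a+1}` ⟹ `−u` HAS ORDER `p^{a+1}`** on a complex torus `X` of dimension `φ(p^{a+1})/2`
(`u ∈ End X`; §1 gives `P_u = Φ_{2p^{a+1}}`). [cite: BirkenhakeLange2004, §13.3] [cite: BambergCairnsKilminster2003, Thm. 1] -/
theorem orderOf_neg_of_orderOf_eq_two_mul_prime_pow {p : ℕ} (hp : p.Prime) (hp2 : p ≠ 2) (a : ℕ)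
    {A : Matrix ι ι ℤ} (hA : A ∈ endRingInt P) (hord : orderOf A = 2 * p ^ (a + 1))
    (hdim : 2 * finrank ℂ E = Nat.totient (p ^ (a + 1))) : orderOf (-A) = p ^ (a + 1) :=
  orderOf_neg_of_charpoly_eq_cyclotomic_two_mul_prime_pow hp hp2 a hA
    (charpoly_eq_cyclotomic_of_orderOf_eq_two_mul_prime_pow hp hp2 a hord
      (by rw [card_eq_two_mul_finrank₃₉ P, hdim]))

/-- **ORDER `p^{a+1}` (`p` odd) ⟹ `−u` HAS ORDER `2p^{a+1}`** on a complex torus of dimension `φ(p^{a+1})/2`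
(FILE 2: `P_u = Φ_{p^{a+1}}`). [cite: BirkenhakeLange2004, §13.3] -/
theorem orderOf_neg_of_orderOf_eq_prime_pow {p : ℕ} (hp : p.Prime) (hp2 : p ≠ 2) (a : ℕ) {A : Matrix ι ι ℤ}
    (hA : A ∈ endRingInt P) (hord : orderOf A = p ^ (a + 1)) (hdim : 2 * finrank ℂ E = Nat.totient (p ^ (a + 1))) :
    orderOf (-A) = 2 * p ^ (a + 1) :=
  haveI : NeZero (p ^ (a + 1)) := ⟨pow_ne_zero _ hp.ne_zero⟩
  orderOf_neg_of_charpoly_eq_cyclotomic_prime_pow hp hp2 a hA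
    (charpoly_eq_cyclotomic_of_orderOf_eq_of_finrank P ⟨p, a + 1, hp.prime, Nat.succ_pos a, rfl⟩ hord hdim)

/-! ### §4 `d = 6`: only one elliptic curve with an automorphism of order `6` -/

/-- **On a one-dimensional complex torus, `u` has order `6` ⟹ `−u` has order `3`.** [cite: BirkenhakeLange2004, §13.3 Cor. 13.3.4] -/
theorem orderOf_neg_eq_three_of_orderOf_eq_six {A : Matrix ι ι ℤ} (hA : A ∈ endRingInt P) (hord : orderOf A = 6)
    (hdim : finrank ℂ E = 1) : orderOf (-A) = 3 := by
  have h := orderOf_neg_of_orderOf_eq_two_mul_prime_pow Nat.prime_three (by norm_num) 0 hA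
    (by rw [hord]; norm_num) (by rw [hdim, zero_add, pow_one, Nat.totient_prime Nat.prime_three])
  rwa [zero_add, pow_one] at h

/-- **… and `u` has order `3` ⟹ `−u` has order `6`.** [cite: BirkenhakeLange2004, §13.3 Cor. 13.3.4] -/
theorem orderOf_neg_eq_six_of_orderOf_eq_three {A : Matrix ι ι ℤ} (hA : A ∈ endRingInt P) (hord : orderOf A = 3)
    (hdim : finrank ℂ E = 1) : orderOf (-A) = 6 := by
  have h := orderOf_neg_of_orderOf_eq_prime_pow Nat.prime_three (by norm_num) 0 hA
    (by rw [hord, zero_add, pow_one]) (by rw [hdim, zero_add, pow_one, Nat.totient_prime Nat.prime_three])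
  rwa [zero_add, pow_one] at h

/-- **THE ELLIPTIC CURVE WITH AN AUTOMORPHISM OF ORDER `6` IS UNIQUE**: any two one-dimensional complex tori with
endomorphisms `u`, `u′` of order `6` are isomorphic — a biholomorphic group isomorphism `g : X ≅ X′` with
`g ∘ (−u)^k = (−u′) ∘ g`, `k ∈ {1, 2}` (`−u`, `−u′` have order `3`: FILE 4 `exists_iso_of_orderOf_eq_three`; both
curves are `ℂ/ℤ[ζ_3]`). [cite: BirkenhakeLange2004, §13.3 Cor. 13.3.4] [cite: Shimura1973, §4.5, p. 106] -/
theorem exists_iso_of_orderOf_eq_six {A : Matrix ι ι ℤ} (hA : A ∈ endRingInt P) (hord : orderOf A = 6)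
    (hdim : finrank ℂ E = 1) {A' : Matrix ι' ι' ℤ} (hA' : A' ∈ endRingInt P') (hord' : orderOf A' = 6)
    (hdim' : finrank ℂ E' = 1) :
    ∃ g : ComplexTorus P ≃+ ComplexTorus P',
      ContMDiff 𝓘(ℂ, E) 𝓘(ℂ, E') ω g ∧ ContMDiff 𝓘(ℂ, E') 𝓘(ℂ, E) ω g.symm ∧
        ∃ k, (k = 1 ∨ k = 2) ∧ ∀ x : ComplexTorus P, g (mapMatrix P P ((-A) ^ k) x) = mapMatrix P' P' (-A') (g x) :=
  exists_iso_of_orderOf_eq_three (Subring.neg_mem _ hA) (orderOf_neg_eq_three_of_orderOf_eq_six hA hord hdim) hdim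
    (Subring.neg_mem _ hA') (orderOf_neg_eq_three_of_orderOf_eq_six hA' hord' hdim') hdim'

/-- The same in the tree's `IsIsomorphic` vocabulary. [cite: BirkenhakeLange2004, §13.3 Cor. 13.3.4] [cite: Shimura1973, §4.5, p. 106] -/
theorem isIsomorphic_of_orderOf_eq_six {A : Matrix ι ι ℤ} (hA : A ∈ endRingInt P) (hord : orderOf A = 6)
    (hdim : finrank ℂ E = 1) {A' : Matrix ι' ι' ℤ} (hA' : A' ∈ endRingInt P') (hord' : orderOf A' = 6)
    (hdim' : finrank ℂ E' = 1) : IsIsomorphic P P' := by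
  obtain ⟨g, hg, hg', -⟩ := exists_iso_of_orderOf_eq_six hA hord hdim hA' hord' hdim'
  exact ⟨g, hg, hg'⟩

/-- **The curve with an automorphism of order `3` IS the curve with an automorphism of order `6`**: a
one-dimensional torus with an endomorphism of order `3` and one with an endomorphism of order `6` are isomorphic.
[cite: BirkenhakeLange2004, §13.3 Cor. 13.3.4] [cite: Shimura1973, §4.5, p. 106] -/
theorem isIsomorphic_of_orderOf_eq_three_six {A : Matrix ι ι ℤ} (hA : A ∈ endRingInt P) (hord : orderOf A = 3)
    (hdim : finrank ℂ E = 1) {A' : Matrix ι' ι' ℤ} (hA' : A' ∈ endRingInt P') (hord' : orderOf A' = 6)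
    (hdim' : finrank ℂ E' = 1) : IsIsomorphic P P' :=
  isIsomorphic_of_orderOf_eq_three hA hord hdim (Subring.neg_mem _ hA')
    (orderOf_neg_eq_three_of_orderOf_eq_six hA' hord' hdim') hdim'

/-! ### §5 `d = 10`: only one abelian surface with an automorphism of order `10` -/

/-- **On a two-dimensional complex torus, `u` has order `10` ⟹ `−u` has order `5`** (and conversely).
[cite: BirkenhakeLange2004, §13.3] [cite: BambergCairnsKilminster2003, Thm. 1] -/
theorem orderOf_neg_eq_five_of_orderOf_eq_ten {A : Matrix ι ι ℤ} (hA : A ∈ endRingInt P) (hord : orderOf A = 10)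
    (hdim : finrank ℂ E = 2) : orderOf (-A) = 5 := by
  have h := orderOf_neg_of_orderOf_eq_two_mul_prime_pow Nat.prime_five (by norm_num) 0 hA
    (by rw [hord]; norm_num) (by rw [hdim, zero_add, pow_one, Nat.totient_prime Nat.prime_five])
  rwa [zero_add, pow_one] at h

/-- `u` of order `5` on a two-dimensional torus ⟹ `−u` of order `10`. [cite: BirkenhakeLange2004, §13.3] -/
theorem orderOf_neg_eq_ten_of_orderOf_eq_five {A : Matrix ι ι ℤ} (hA : A ∈ endRingInt P) (hord : orderOf A = 5)
    (hdim : finrank ℂ E = 2) : orderOf (-A) = 10 := by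
  have h := orderOf_neg_of_orderOf_eq_prime_pow Nat.prime_five (by norm_num) 0 hA
    (by rw [hord, zero_add, pow_one]) (by rw [hdim, zero_add, pow_one, Nat.totient_prime Nat.prime_five])
  rwa [zero_add, pow_one] at h

/-- **THE ABELIAN SURFACE WITH AN AUTOMORPHISM OF ORDER `10` IS UNIQUE**: any two `2`-dimensional complex tori with
endomorphisms of order `10` are isomorphic (`−u`, `−u′` have order `5`; FILE 5: one abelian surface with an
automorphism of order `5`, `ℂ²/Φ(𝓞_{ℚ(ζ_5)})`). [cite: BirkenhakeLange2004, §13.3] [cite: Shimura1998, §8.4 (2), p. 73] -/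
theorem isIsomorphic_of_orderOf_eq_ten {A : Matrix ι ι ℤ} (hA : A ∈ endRingInt P) (hord : orderOf A = 10)
    (hdim : finrank ℂ E = 2) {A' : Matrix ι' ι' ℤ} (hA' : A' ∈ endRingInt P') (hord' : orderOf A' = 10)
    (hdim' : finrank ℂ E' = 2) : IsIsomorphic P P' := by
  obtain ⟨g, hg, hg', -⟩ := exists_iso_of_orderOf_eq_five (Subring.neg_mem _ hA)
    (orderOf_neg_eq_five_of_orderOf_eq_ten hA hord hdim) hdim (Subring.neg_mem _ hA')
    (orderOf_neg_eq_five_of_orderOf_eq_ten hA' hord' hdim') hdim'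
  exact ⟨g, hg, hg'⟩

/-- **The surface with an automorphism of order `5` IS the surface with an automorphism of order `10`.**
[cite: BirkenhakeLange2004, §13.3] [cite: Shimura1998, §8.4 (2), p. 73] -/
theorem isIsomorphic_of_orderOf_eq_five_ten {A : Matrix ι ι ℤ} (hA : A ∈ endRingInt P) (hord : orderOf A = 5)
    (hdim : finrank ℂ E = 2) {A' : Matrix ι' ι' ℤ} (hA' : A' ∈ endRingInt P') (hord' : orderOf A' = 10)
    (hdim' : finrank ℂ E' = 2) : IsIsomorphic P P' := by
  obtain ⟨g, hg, hg', -⟩ := exists_iso_of_orderOf_eq_five hA hord hdim (Subring.neg_mem _ hA')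
    (orderOf_neg_eq_five_of_orderOf_eq_ten hA' hord' hdim') hdim'
  exact ⟨g, hg, hg'⟩

end Torus

end ComplexTorus

end Literature.Geometry.Kaehler
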